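import Summits.QuantumFields.BalabanUV.T4Continuum.Support.NE7MarginalL1Currency
import HarnessLib

/-!
# NE7MarginalL1Strict — route ℓ¹ of the NE7 crux: the ℓ¹ currency ACCEPTS marginal inputs that NO geometric `InjectedRate` accepts
# (kernel witness §1: the inverse-square shift profile passes node U6 in ℓ¹ currency and fits NO `InjectedRate C e θ`, θ < 1), and — v1.1 §2 —
# as PREDICATES on the injection the two consumer currencies are INCOMPARABLE once a polynomial allowance `e ≥ 1` is admitted; what IS an
# inclusion: pure geometric with zero corner ⊂ smear-ℓ¹ (consumer level), geometric ⊂ ℓ¹ plainly (supplier level, `NE7MarginalL1Supply` §4)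

Cell `pub-balaban`, rung (B)+1 sub-cell t4, lineage `b2b-balaban-t4-ne7-p1`, generation 28 (CRUX PROVER NE7 #1, ruling e34b3e0c item (2)); route
ℓ¹ = `t4/ROUTES-NE7.md` §L2.1 (rank 1 → t4-ne7-p1; cell C-L1°), the claim of its step A1 «the tree's `InjectedRate` (geometric × polynomial) is a
strict sub-case, and e.g. `σ_i = (i+1)^{−3∕2}` is admissible here and inexpressible there» made kernel with the inverse-SQUARE profile (same point,
integer exponent).  Companion of `NE7MarginalL1Currency` (p272763).  HONEST FRAMING (page 1): FIXED FINITE T⁴, rung (B)+1; NE7 NOT PRINTED in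
[Balaban1984PropagatorsI]–[Balaban1989LargeFieldII], NOT PROVED here; continuum YM on T⁴ ⇐ BetaPertH ∧ nine spine estimates (0/9 proved); BetaPertH
⇐ (D1) ∧ (D4) ∧ CAP+tail; G-an2-4 gates asym, D1 and NE2/3/4; NOT infinite volume, NOT mass gap, NOT Clay.

WHAT ([folklore] real analysis; 0 def, 0 sorry; nothing of Bałaban asserted):
* **`summable_delta_tailInj_invSq`** — the equality-case injection `tailInj (fun i ↦ 1∕(i+1)²)` (`TailDominated 1`) HAS summable transported totals
  `delta E ρ · ` for every `ρ ∈ [0,1[`, `E ≥ 0` (`NE7MarginalL1Currency.summable_delta_of_tailDominated`) — it passes node U6 in ℓ¹ currency;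
* **`not_injectedRate_tailInj_invSq`** — and it satisfies NO `T4CauchySum.InjectedRate C e θ` with `θ ∈ [0,1[`, for any constant `C` and any polynomial
  allowance `e`: at `K = m+1`, `j = m` the injection is `1∕(m+1)²` while `C(m+2)^eθ^m·(m+1)² → 0`.
So the set of marginal inputs the δ-road accepts is GENUINELY enlarged by the ℓ¹ typing (not only re-worded): together with
`NE7MarginalL1Currency.thresholdExact` (nothing weaker than ℓ¹ passes) the currency is pinned from both sides.  NE7 NOT proved; NOT summit progress.

v1.1 (generation 29, 2026-08-21; §1 byte-identical to v1 p274372; the title's v1 wording «STRICTLY WEAKER … at the CONSUMER level» CORRECTED — it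
presupposed an inclusion between the consumer PREDICATES that is not literal: NIT-W of the route-ℓ¹ author's XREAD X5, `t4/ROUTES-NE7.md` §L2.20 J-2,
certificate `t4/ideate/NE7/lens2-g19/xreadL1A/XREAD-L1A-NE7MarginalL1-p273989-p274372.md`).  §2 THE PRECISE COMPARISON, ported WITH CREDIT from the
reader's scratch `t4/ideate/NE7/lens2-g19/xreadL1A/X_L1A.lean` (planner-b2b-balaban-t4-ne7-idea-2-g19-0, items N-A ∕ N-B ∕ N-C; proofs essentially
verbatim, names kept):
* (N-A) **`injectedRate_polyGeom`** ∕ **`polyGeom_not_tailDominated`** ∕ **`polyGeom_not_smearDominated`** — the injection `(K+1)·θ^j` IS the tree's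
  `InjectedRate 1 1 θ` yet is `TailDominated M σ` ∕ `SmearDominated M ω σ` for NO summable nonnegative `σ` (read at `j = 0`: `K+1 ≤ |M|·Σσ` fails for
  large `K`); **`geom_not_tailDominated`** — even `θ^j` (`InjectedRate 1 0 θ`) is not `TailDominated` (corner `j = K = 0`: `1 ≤ M·0`).  With §1: as
  predicates on `inj` the geometric-with-allowance class and the two ℓ¹ classes are INCOMPARABLE (**`consumerPredicates_incomparable`** packages both
  witnesses); what the ℓ¹ typing enlarges is the set of inputs the δ-road ACCEPTS (each class separately implies `Summable (delta E ρ inj)`).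
* (N-B) **`smearDominated_of_injectedRate_zero`** — what IS an inclusion at the consumer level: `InjectedRate C 0 θ` (no allowance) with the corner value
  `inj 0 0 = 0` ⇒ `SmearDominated C θ (θ^·)` (summable profile for `θ < 1`); strict by §1.
* (N-C) **`not_summable_delta_tailInj_harmonic`** — the statement-level reason the exponent `2` of §1 cannot be `1`: the harmonic profile's transported
  totals are not summable for any `ρ > 0` (`NE7MarginalL1Currency.not_summable_delta_tailInj` + Mathlib's harmonic series).
[folklore] real analysis throughout; 0 def, 0 sorry; nothing of Bałaban asserted; NE7 NOT proved; NOT summit progress.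

v1.2 (generation 29, same day; §1–§2 byte-identical to v1.1 p277449).  §3 THE CORNER-FREE FORM OF (N-A), answering the located INFO of the first
outside reader of v1.1 (ne9-formalise-leaf-06 g45, HOME/INBOX.md block 14:1xZ: in `polyGeom_not_tailDominated` ∕ `polyGeom_not_smearDominated` the
binders `hσ`, `hs` are IDLE — both negations already hold at the corner `K = j = 0`, where the ℓ¹ shapes force `inj 0 0 ≤ M·0`).  RIGHT; and the honest
content of (N-A) is NOT a corner artefact: PIN the polynomial-allowance injection to zero at `j = K` (as every ℓ¹-dominated injection is pinned) —
`polyGeomPinned θ K j = if j = K then 0 else (K+1)·θ^j` — then it is still `InjectedRate 1 1 θ` (**`injectedRate_polyGeomPinned`**), and it is STILL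
outside both ℓ¹ classes for every summable nonnegative `σ` (**`polyGeomPinned_not_tailDominated`** ∕ **`polyGeomPinned_not_smearDominated`**: read at
`j = 0 < K`: `K + 1 ≤ |M|·Σσ` fails for `K` large), packaged corner-free as **`consumerPredicates_incomparable_pinned`**.  Here the summability binder
IS load-bearing: against the NON-summable profile `σ ≡ 1` the pinned injection is smear-dominated (for `j < K`, `smear ω 1 K j ≥ K − j` and
`(K+1)θ^j ≤ 2·max(1, θ∕(1−θ))·(K−j)` by Bernoulli — elementary, not filed), i.e. the incomparability is exactly a statement about the ℓ¹ REGIME.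
-/

noncomputable section

open Finset Filter Topology

namespace Summit.QuantumFields.BalabanUV.T4Continuum.NE7MarginalL1Strict

open Literature.MathematicalPhysics.QuantumFieldTheory.Balaban1983to89
open T4CauchySum (delta InjectedRate)
open NE7MarginalL1Currency (tailInj TailDominated tailDominated_tailInj summable_delta_of_tailDominated)

/-! ## §1 The inverse-square witness (v1) -/

/-- The inverse-square shift profile `σ_i = 1∕(i+1)²` is nonnegative. [folklore] -/
theorem invSq_nonneg (i : ℕ) : 0 ≤ 1 / ((i : ℝ) + 1) ^ 2 := by positivity

/-- **THE INVERSE-SQUARE PROFILE PASSES NODE U6 IN ℓ¹ CURRENCY**: the equality-case injection `tailInj (fun i ↦ 1∕(i+1)²) K j = Σ_{i∈[j,K)} 1∕(i+1)²` is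
`TailDominated 1` by a summable sequence (the p = 2 series — the tree's `WellPoisedFaceRate.summable_shift_sq` states the same series; re-derived
inline from `Real.summable_one_div_nat_pow` to keep this file's imports inside the cell), hence `Summable (delta E ρ (tailInj ·))` for every
`ρ ∈ [0,1[`, `E ≥ 0`. [folklore] -/
theorem summable_delta_tailInj_invSq {E ρ : ℝ} (hE : 0 ≤ E) (hρ0 : 0 ≤ ρ) (hρ1 : ρ < 1) :
    Summable (delta E ρ (tailInj fun i => 1 / ((i : ℝ) + 1) ^ 2)) := by
  have hsq : Summable (fun i : ℕ => 1 / ((i : ℝ) + 1) ^ 2) := by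
    have h1 := (summable_nat_add_iff 1).mpr (Real.summable_one_div_nat_pow.mpr (by norm_num : 1 < 2))
    refine h1.congr fun n => ?_
    push_cast
    ring_nf
  exact summable_delta_of_tailDominated (tailDominated_tailInj invSq_nonneg) hE zero_le_one invSq_nonneg hsq hρ0 hρ1

/-- The diagonal value of the equality-case injection one scale below the pin: `tailInj σ (m+1) m = σ_m`. [folklore] -/
theorem tailInj_succ_self (σ : ℕ → ℝ) (m : ℕ) : tailInj σ (m + 1) m = σ m := by
  unfold tailInj
  rw [Nat.Ico_succ_singleton, Finset.sum_singleton]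

/-- **… AND FITS NO GEOMETRIC `InjectedRate`.**  For any `θ ∈ [0,1[`, any constant `C` and any polynomial allowance `e`, the injection
`tailInj (fun i ↦ 1∕(i+1)²)` violates `T4CauchySum.InjectedRate C e θ` (`inj K j ≤ C(K+1)^eθ^j`): at `K = m+1`, `j = m` the left side is `1∕(m+1)²`
while `(m+1)²·C(m+2)^eθ^m ≤ |C|·3^{e+2}·(m^{e+2}θ^m) → 0`.  With `summable_delta_tailInj_invSq`: the ℓ¹ currency admits STRICTLY more marginal
inputs than the geometric one at the consumer level (cf. `NE7MarginalL1Supply` §4: at the supplier level geometric ⊂ ℓ¹ plainly). [folklore] -/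
theorem not_injectedRate_tailInj_invSq {C θ : ℝ} (hθ0 : 0 ≤ θ) (hθ1 : θ < 1) (e : ℕ) :
    ¬ InjectedRate C e θ (tailInj fun i => 1 / ((i : ℝ) + 1) ^ 2) := by
  intro h
  have hθabs : |θ| < 1 := abs_lt.mpr ⟨by linarith, hθ1⟩
  -- |C|·3^{e+2}·(m^{e+2} θ^m) → 0
  have hT : Tendsto (fun m : ℕ => |C| * 3 ^ (e + 2) * ((m : ℝ) ^ (e + 2) * θ ^ m)) atTop (𝓝 0) := by
    simpa using (tendsto_pow_const_mul_const_pow_of_abs_lt_one (e + 2) hθabs).const_mul (|C| * 3 ^ (e + 2))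
  have hev : ∀ᶠ m : ℕ in atTop, |C| * 3 ^ (e + 2) * ((m : ℝ) ^ (e + 2) * θ ^ m) < 1 :=
    hT.eventually (eventually_lt_nhds (by norm_num))
  obtain ⟨m, hm1, hm2⟩ := ((eventually_ge_atTop 1).and hev).exists
  -- the shape at K = m+1, j = m
  have hup : tailInj (fun i => 1 / ((i : ℝ) + 1) ^ 2) (m + 1) m ≤ C * ((((m + 1 : ℕ) : ℝ)) + 1) ^ e * θ ^ m :=
    (h (m + 1) m (Nat.le_succ m)).2
  rw [tailInj_succ_self] at hup
  have hm1r : (1 : ℝ) ≤ m := by exact_mod_cast hm1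
  have hmpos : (0 : ℝ) < (m : ℝ) + 1 := by positivity
  -- multiply through by (m+1)²
  have hup' : 1 ≤ ((m : ℝ) + 1) ^ 2 * (C * ((((m + 1 : ℕ) : ℝ)) + 1) ^ e * θ ^ m) := by
    have := mul_le_mul_of_nonneg_left hup (sq_nonneg ((m : ℝ) + 1))
    rwa [show ((m : ℝ) + 1) ^ 2 * (1 / ((m : ℝ) + 1) ^ 2) = 1 by field_simp] at this
  have hX0 : 0 ≤ ((((m + 1 : ℕ) : ℝ)) + 1) ^ e * θ ^ m := by positivity
  have hX1 : ((m : ℝ) + 1) ^ 2 * ((((m + 1 : ℕ) : ℝ)) + 1) ^ e ≤ (3 : ℝ) ^ (e + 2) * (m : ℝ) ^ (e + 2) := by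
    have h2 : ((m : ℝ) + 1) ^ 2 ≤ ((3 : ℝ) * m) ^ 2 := pow_le_pow_left₀ hmpos.le (by linarith) 2
    have h3 : ((((m + 1 : ℕ) : ℝ)) + 1) ^ e ≤ ((3 : ℝ) * m) ^ e := by
      apply pow_le_pow_left₀ (by positivity)
      push_cast
      linarith
    calc ((m : ℝ) + 1) ^ 2 * ((((m + 1 : ℕ) : ℝ)) + 1) ^ e ≤ ((3 : ℝ) * m) ^ 2 * ((3 : ℝ) * m) ^ e :=
          mul_le_mul h2 h3 (by positivity) (by positivity)
      _ = (3 : ℝ) ^ (e + 2) * (m : ℝ) ^ (e + 2) := by ring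
  have hbound : ((m : ℝ) + 1) ^ 2 * (C * ((((m + 1 : ℕ) : ℝ)) + 1) ^ e * θ ^ m) ≤ |C| * 3 ^ (e + 2) * ((m : ℝ) ^ (e + 2) * θ ^ m) := by
    calc ((m : ℝ) + 1) ^ 2 * (C * ((((m + 1 : ℕ) : ℝ)) + 1) ^ e * θ ^ m)
        = C * (((m : ℝ) + 1) ^ 2 * ((((m + 1 : ℕ) : ℝ)) + 1) ^ e * θ ^ m) := by ring
      _ ≤ |C| * (((m : ℝ) + 1) ^ 2 * ((((m + 1 : ℕ) : ℝ)) + 1) ^ e * θ ^ m) :=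
          mul_le_mul_of_nonneg_right (le_abs_self C) (by positivity)
      _ ≤ |C| * ((3 : ℝ) ^ (e + 2) * (m : ℝ) ^ (e + 2) * θ ^ m) :=
          mul_le_mul_of_nonneg_left (mul_le_mul_of_nonneg_right hX1 (pow_nonneg hθ0 m)) (abs_nonneg C)
      _ = |C| * 3 ^ (e + 2) * ((m : ℝ) ^ (e + 2) * θ ^ m) := by ring
  linarith

/-! ## §2 (v1.1) The precise comparison of the consumer currencies — ported with credit from idea-2 g19's `X_L1A.lean` (N-A ∕ N-B ∕ N-C) -/

open NE7MarginalL1Currency (smear SmearDominated not_summable_delta_tailInj)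

/-- (N-A, part 1) The injection `(K+1)·θ^j` satisfies the tree's `InjectedRate 1 1 θ` (polynomial allowance `e = 1`). [folklore]
(ported from `t4/ideate/NE7/lens2-g19/xreadL1A/X_L1A.lean`, planner-b2b-balaban-t4-ne7-idea-2-g19-0) -/
theorem injectedRate_polyGeom {θ : ℝ} (hθ : 0 ≤ θ) : InjectedRate 1 1 θ (fun K j => ((K : ℝ) + 1) * θ ^ j) := by
  intro K j _
  refine ⟨by positivity, ?_⟩
  simp

/-- (N-A, part 2) … but `(K+1)·θ^j` is `TailDominated M σ` for NO summable nonnegative `σ`: read at `j = 0`, `K + 1 ≤ M·Σ_{i<K} σ_i ≤ |M|·Σσ`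
fails for `K` large. [folklore] (ported from idea-2 g19's `X_L1A.lean`) -/
theorem polyGeom_not_tailDominated {θ M : ℝ} {σ : ℕ → ℝ} (hσ : ∀ i, 0 ≤ σ i) (hs : Summable σ) :
    ¬ TailDominated M σ (fun K j => ((K : ℝ) + 1) * θ ^ j) := by
  intro h
  obtain ⟨K, hK⟩ := exists_nat_gt (|M| * ∑' i, σ i)
  have h0 := (h K 0 (Nat.zero_le K)).2
  simp only [pow_zero, mul_one] at h0
  have h1 : M * ∑ i ∈ Ico 0 K, σ i ≤ |M| * ∑' i, σ i :=
    calc M * ∑ i ∈ Ico 0 K, σ i ≤ |M| * ∑ i ∈ Ico 0 K, σ i :=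
          mul_le_mul_of_nonneg_right (le_abs_self M) (sum_nonneg fun i _ => hσ i)
      _ ≤ |M| * ∑' i, σ i := mul_le_mul_of_nonneg_left (hs.sum_le_tsum _ fun i _ => hσ i) (abs_nonneg M)
  linarith

/-- (N-A, part 3) … nor `SmearDominated M ω σ` for any `ω` and any summable nonnegative `σ` (same reading: `smear ω σ K 0 = Σ_{l<K} σ_l`, the
exponent `(0 − l)₊ = 0` in ℕ). [folklore] (ported from idea-2 g19's `X_L1A.lean`) -/
theorem polyGeom_not_smearDominated {θ M ω : ℝ} {σ : ℕ → ℝ} (hσ : ∀ i, 0 ≤ σ i) (hs : Summable σ) :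
    ¬ SmearDominated M ω σ (fun K j => ((K : ℝ) + 1) * θ ^ j) := by
  intro h
  obtain ⟨K, hK⟩ := exists_nat_gt (|M| * ∑' i, σ i)
  have h0 := (h K 0 (Nat.zero_le K)).2
  simp only [pow_zero, mul_one, smear, Nat.zero_sub] at h0
  have h1 : M * ∑ l ∈ range K, σ l ≤ |M| * ∑' i, σ i :=
    calc M * ∑ l ∈ range K, σ l ≤ |M| * ∑ l ∈ range K, σ l :=
          mul_le_mul_of_nonneg_right (le_abs_self M) (sum_nonneg fun i _ => hσ i)
      _ ≤ |M| * ∑' i, σ i := mul_le_mul_of_nonneg_left (hs.sum_le_tsum _ fun i _ => hσ i) (abs_nonneg M)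
  linarith

/-- (N-A, part 4) Even the pure geometric injection `θ^j` (the tree's `InjectedRate 1 0 θ`) is not `TailDominated M σ`, for ANY `M`, `σ`: at the
corner `j = K = 0` the tail sum is empty (`θ^0 = 1 ≤ M·0` fails).  The ℓ¹ shapes book the injection AT the pin as zero; the geometric shape does
not. [folklore] (ported from idea-2 g19's `X_L1A.lean`) -/
theorem geom_not_tailDominated {θ M : ℝ} {σ : ℕ → ℝ} : ¬ TailDominated M σ (fun _ j => θ ^ j) := by
  intro h
  have := (h 0 0 le_rfl).2
  simp at this
  linarith

/-- **(N-A packaged) THE CONSUMER PREDICATES ARE INCOMPARABLE.**  For every `θ ∈ [0,1[`: (i) some injection satisfies the geometric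
`InjectedRate 1 1 θ` and is dominated by NO summable nonnegative tail or smear (any `M`, any `ω`); (ii) some injection is `TailDominated 1 σ` by a
summable nonnegative `σ` and satisfies NO `InjectedRate C e θ'` with `θ' ∈ [0,1[` (§1's inverse-square witness).  Both classes separately imply
`Summable (delta E ρ ·)` (`T4CauchySum.summable_delta`, `NE7MarginalL1Currency.summable_delta_of_tailDominated` ∕ `…_of_smearDominated`), so the
δ-road's ACCEPTED INPUT SET is enlarged by admitting the ℓ¹ classes — the correct form of v1's title sentence. [folklore] -/
theorem consumerPredicates_incomparable {θ : ℝ} (hθ0 : 0 ≤ θ) :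
    (∃ inj : ℕ → ℕ → ℝ, InjectedRate 1 1 θ inj ∧
        ∀ (M ω : ℝ) (σ : ℕ → ℝ), (∀ i, 0 ≤ σ i) → Summable σ → ¬ TailDominated M σ inj ∧ ¬ SmearDominated M ω σ inj) ∧
      (∃ inj : ℕ → ℕ → ℝ, (∃ σ : ℕ → ℝ, (∀ i, 0 ≤ σ i) ∧ Summable σ ∧ TailDominated 1 σ inj) ∧
        ∀ (C θ' : ℝ) (e : ℕ), 0 ≤ θ' → θ' < 1 → ¬ InjectedRate C e θ' inj) := by
  refine ⟨⟨fun K j => ((K : ℝ) + 1) * θ ^ j, injectedRate_polyGeom hθ0, fun M ω σ hσ hs =>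
      ⟨polyGeom_not_tailDominated hσ hs, polyGeom_not_smearDominated hσ hs⟩⟩,
    ⟨tailInj fun i => 1 / ((i : ℝ) + 1) ^ 2, ⟨fun i => 1 / ((i : ℝ) + 1) ^ 2, invSq_nonneg, ?_, tailDominated_tailInj invSq_nonneg⟩,
      fun C θ' e hθ'0 hθ'1 => not_injectedRate_tailInj_invSq hθ'0 hθ'1 e⟩⟩
  have h1 := (summable_nat_add_iff 1).mpr (Real.summable_one_div_nat_pow.mpr (by norm_num : 1 < 2))
  refine h1.congr fun n => ?_
  push_cast
  ring_nf

/-- **(N-B) WHAT IS AN INCLUSION AT THE CONSUMER LEVEL**: the pure geometric class WITHOUT polynomial allowance and with the corner value zero —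
`InjectedRate C 0 θ inj` and `inj 0 0 = 0` — IS `SmearDominated C θ (θ^·)` (profile `l ↦ θ^l`, summable for `θ < 1`): for `K ≥ 1` the `l = 0` term
of `smear θ (θ^·) K j` alone is `θ^j`.  Strict by §1 (`not_injectedRate_tailInj_invSq`). [folklore] (ported from idea-2 g19's `X_L1A.lean`) -/
theorem smearDominated_of_injectedRate_zero {C θ : ℝ} {inj : ℕ → ℕ → ℝ} (hθ : 0 ≤ θ) (h : InjectedRate C 0 θ inj)
    (h00 : inj 0 0 = 0) : SmearDominated C θ (fun l => θ ^ l) inj := by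
  have hC : 0 ≤ C := by
    have h0 := h 0 0 le_rfl
    simp only [Nat.cast_zero, zero_add, pow_zero, mul_one] at h0
    linarith [h0.1, h0.2]
  intro K j hj
  refine ⟨(h K j hj).1, ?_⟩
  rcases Nat.eq_zero_or_pos K with hK | hK
  · subst hK
    obtain rfl : j = 0 := Nat.le_zero.mp hj
    rw [h00]
    exact mul_nonneg hC (sum_nonneg fun l _ => by positivity)
  · have hle : θ ^ j ≤ smear θ (fun l => θ ^ l) K j := by
      have hmem : 0 ∈ range K := mem_range.mpr hK
      have h1 := single_le_sum (s := range K) (f := fun l => θ ^ l * θ ^ (j - l)) (fun l _ => by positivity) hmem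
      simpa [smear] using h1
    calc inj K j ≤ C * ((K : ℝ) + 1) ^ 0 * θ ^ j := (h K j hj).2
      _ = C * θ ^ j := by simp
      _ ≤ C * smear θ (fun l => θ ^ l) K j := mul_le_mul_of_nonneg_left hle hC

/-- **(N-C) THE EXPONENT OF §1 CANNOT BE LOWERED TO 1**: the harmonic profile `σ_i = 1∕(i+1)` is not summable, so by the exactness half of the
currency (`NE7MarginalL1Currency.not_summable_delta_tailInj`) the transported totals of `tailInj σ` are NOT summable for any `ρ > 0` — the
statement-level witness behind the reader's mutant MS1. [folklore] (ported from idea-2 g19's `X_L1A.lean`) -/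
theorem not_summable_delta_tailInj_harmonic {ρ : ℝ} (hρ : 0 < ρ) :
    ¬ Summable (delta 1 ρ (tailInj fun i => 1 / ((i : ℝ) + 1))) := by
  refine not_summable_delta_tailInj (fun i => by positivity) hρ ?_
  intro h1
  have h2 : Summable (fun i : ℕ => 1 / ((↑(i + 1) : ℝ))) := by
    refine h1.congr fun i => ?_
    push_cast
    ring
  exact Real.not_summable_one_div_natCast ((summable_nat_add_iff 1).mp h2)

/-! ## §3 (v1.2) The corner-free form of (N-A): pin the polynomial-allowance injection at `j = K` -/

/-- The polynomial-allowance injection PINNED to zero at the last scale: `polyGeomPinned θ K j = 0` if `j = K`, else `(K+1)·θ^j` (an `abbrev`-free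
lambda is used in the statements; this docstring names it). [folklore] -/
theorem injectedRate_polyGeomPinned {θ : ℝ} (hθ : 0 ≤ θ) :
    InjectedRate 1 1 θ (fun K j => if j = K then 0 else ((K : ℝ) + 1) * θ ^ j) := by
  intro K j _
  by_cases hjK : j = K
  · simp only [hjK, if_true]
    exact ⟨le_rfl, by positivity⟩
  · simp only [hjK, if_false]
    exact ⟨by positivity, by simp⟩

/-- (N-A, corner-free) The PINNED injection is `TailDominated M σ` for NO summable nonnegative `σ` and no `M`: at `j = 0 < K` the shape demands
`K + 1 ≤ M·Σ_{i<K} σ_i ≤ |M|·Σσ`, false for `K` large.  Here `hσ`, `hs` are load-bearing (cf. the header's `σ ≡ 1` remark). [folklore] -/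
theorem polyGeomPinned_not_tailDominated {θ M : ℝ} {σ : ℕ → ℝ} (hσ : ∀ i, 0 ≤ σ i) (hs : Summable σ) :
    ¬ TailDominated M σ (fun K j => if j = K then 0 else ((K : ℝ) + 1) * θ ^ j) := by
  intro h
  obtain ⟨K, hK⟩ := exists_nat_gt (|M| * ∑' i, σ i)
  have hKpos : K ≠ 0 := by
    rintro rfl
    have : (0 : ℝ) ≤ |M| * ∑' i, σ i := mul_nonneg (abs_nonneg M) (tsum_nonneg hσ)
    simp at hK
    linarith
  have h0 := (h K 0 (Nat.zero_le K)).2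
  simp only [(Nat.pos_of_ne_zero hKpos).ne, if_false, pow_zero, mul_one] at h0
  have h1 : M * ∑ i ∈ Ico 0 K, σ i ≤ |M| * ∑' i, σ i :=
    calc M * ∑ i ∈ Ico 0 K, σ i ≤ |M| * ∑ i ∈ Ico 0 K, σ i :=
          mul_le_mul_of_nonneg_right (le_abs_self M) (sum_nonneg fun i _ => hσ i)
      _ ≤ |M| * ∑' i, σ i := mul_le_mul_of_nonneg_left (hs.sum_le_tsum _ fun i _ => hσ i) (abs_nonneg M)
  linarith

/-- (N-A, corner-free) … nor `SmearDominated M ω σ`, for any `ω`, any `M` and any summable nonnegative `σ` (at `j = 0 < K`, `smear ω σ K 0 = Σ_{l<K} σ_l`).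
[folklore] -/
theorem polyGeomPinned_not_smearDominated {θ M ω : ℝ} {σ : ℕ → ℝ} (hσ : ∀ i, 0 ≤ σ i) (hs : Summable σ) :
    ¬ SmearDominated M ω σ (fun K j => if j = K then 0 else ((K : ℝ) + 1) * θ ^ j) := by
  intro h
  obtain ⟨K, hK⟩ := exists_nat_gt (|M| * ∑' i, σ i)
  have hKpos : K ≠ 0 := by
    rintro rfl
    have : (0 : ℝ) ≤ |M| * ∑' i, σ i := mul_nonneg (abs_nonneg M) (tsum_nonneg hσ)
    simp at hK
    linarith
  have h0 := (h K 0 (Nat.zero_le K)).2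
  simp only [(Nat.pos_of_ne_zero hKpos).ne, if_false, pow_zero, mul_one, smear, Nat.zero_sub] at h0
  have h1 : M * ∑ l ∈ range K, σ l ≤ |M| * ∑' i, σ i :=
    calc M * ∑ l ∈ range K, σ l ≤ |M| * ∑ l ∈ range K, σ l :=
          mul_le_mul_of_nonneg_right (le_abs_self M) (sum_nonneg fun i _ => hσ i)
      _ ≤ |M| * ∑' i, σ i := mul_le_mul_of_nonneg_left (hs.sum_le_tsum _ fun i _ => hσ i) (abs_nonneg M)
  linarith

/-- **(N-A packaged, CORNER-FREE) THE CONSUMER PREDICATES ARE INCOMPARABLE IN THE ℓ¹ REGIME, NOT BY A CORNER ARTEFACT.**  For every `θ ∈ [0,1[`: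
(i) some injection PINNED to zero at `j = K` satisfies `InjectedRate 1 1 θ` and is dominated by no SUMMABLE nonnegative tail or smear (any `M`, any
`ω`); (ii) = §2 (ii) (§1's inverse-square witness, itself pinned: `tailInj σ K K = 0`). [folklore] -/
theorem consumerPredicates_incomparable_pinned {θ : ℝ} (hθ0 : 0 ≤ θ) :
    (∃ inj : ℕ → ℕ → ℝ, (∀ K, inj K K = 0) ∧ InjectedRate 1 1 θ inj ∧
        ∀ (M ω : ℝ) (σ : ℕ → ℝ), (∀ i, 0 ≤ σ i) → Summable σ → ¬ TailDominated M σ inj ∧ ¬ SmearDominated M ω σ inj) ∧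
      (∃ inj : ℕ → ℕ → ℝ, (∀ K, inj K K = 0) ∧ (∃ σ : ℕ → ℝ, (∀ i, 0 ≤ σ i) ∧ Summable σ ∧ TailDominated 1 σ inj) ∧
        ∀ (C θ' : ℝ) (e : ℕ), 0 ≤ θ' → θ' < 1 → ¬ InjectedRate C e θ' inj) := by
  obtain ⟨-, inj₂, ⟨σ, hσ, hs, hT⟩, hno⟩ := consumerPredicates_incomparable hθ0
  refine ⟨⟨fun K j => if j = K then 0 else ((K : ℝ) + 1) * θ ^ j, fun K => by simp, injectedRate_polyGeomPinned hθ0,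
      fun M ω σ hσ hs => ⟨polyGeomPinned_not_tailDominated hσ hs, polyGeomPinned_not_smearDominated hσ hs⟩⟩,
    ⟨inj₂, fun K => ?_, ⟨σ, hσ, hs, hT⟩, hno⟩⟩
  -- a `TailDominated` injection vanishes at the pin: `0 ≤ inj K K ≤ 1·Σ_{i∈Ico K K} σ_i = 0`
  have h := hT K K le_rfl
  simp only [Ico_self, sum_empty, mul_zero] at h
  linarith [h.1, h.2]

end Summit.QuantumFields.BalabanUV.T4Continuum.NE7MarginalL1Strict

end
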